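import Summits.BirchSwinnertonDyer.BirchSwinnertonDyer.Theorems.PrintX9MuPartStabilizedWeakLetters
import Literature.NumberTheory.EllipticCurves.CastellaGrossiSkinner2025.HeegnerKolyvaginBoundAnyClassNumberProofs
import Literature.NumberTheory.EllipticCurves.SkinnerUrban2014.CharacteristicIdealBaseChangeProofs
import Literature.NumberTheory.EllipticCurves.IwasawaAlgebraRankOneIdealProofs
import Literature.NumberTheory.EllipticCurves.IwasawaAlgebraPromotionProofs
import HarnessLib

/-!
# The shared μ-letter `MuPartStabilizedOfPrint` AWAY FROM `(p)` is a theorem of print — first rung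
# (T3 / BC5 record) for the residual μ-crux of rows 9 (PrintX9, under 27077) and 10 (PrintX10b, under 27275)

Cell `pub/bsd-print-x9`, seat `bsd-trib-w-tld` (tribunal-w, bc5-witness planner) g10, 2026-08-28. PROOFS +
two statement `def`s; no `sorry`, no new axiom, no instance, no notation. ROUTE-INDEPENDENT (imports no `Theses`
file, exactly like the letter module `PrintX9MuPartStabilizedDefs`, p625984), so that both route cones can cite it;
the BY-ID corollaries over the two routes' `closes` binders `hCGS : CGSHowardDivisibilityPLocalized`
(stmt-BirchSwinnertonDyer-27112 on PrintX9; the same-named binder on PrintX10b) live in the companion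
`PrintX9MuPartStabilizedOffPRungById.lean` (not landed with this file). LANDED VERBATIM (this provenance sentence
added) by seat `bsd-line-x10b-p2` LEAD g4 on plan g10's ask (STATUS 2026-08-28T12:09:49Z), `--supports
stmt-BirchSwinnertonDyer-27077` helper; source `HOME/trib-w-tld/PrintX9MuPartStabilizedOffPRung.g10.lean`, sha16 101e756507431a84.

WHAT IS PROVED. The letter of record for the one beyond-print item of rows 9/10,
`HeegnerMuPartStabilized.MuPartStabilizedOfPrint` (p625984), asserts Howard's local inequality
`length_𝔭(𝒳_tors) ≤ 2 · length_𝔭(𝔖/Λκ_∞(C))` AT THE ONE height-one prime `𝔭 = (p)` of `Λ = ℤ_p⟦T⟧`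
(the μ-part), under `CastellaGrossiLeeSkinner2022.Thm413Hypotheses` + the Mastella–Zerman image hypotheses +
`p ∣ h_K`. THIS FILE proves the SAME inequality at EVERY OTHER height-one prime `𝔮 ≠ (p)` — with the letter's
binder list verbatim (`MuPartStabilizedOfPrintOffP`, most binders unused), with THE SHARED ITEM's coherent-pair text
verbatim (`MuPartStabilizedCoherentPairOffP` = p630902 `MuPartStabilizedCoherentPair` = THE CUT v2's `MuInequalityCoherentPair`
with the prime changed; engine `exists_coherent_pair_envelope`), and in its honest minimal form
(`StabilizedLengthBoundOffP`: `Thm413Hypotheses` and `𝔖/Λκ_∞(C)` torsion only; ANY class number, ANY Selmer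
corank, no image hypothesis beyond `E(K)[p] = 0`) — from ONE cite-only named fact already binding both routes'
`closes`: Castella–Grossi–Skinner, Math. Ann. 393 (2025) Thm. 6.5.2
(`CastellaGrossiSkinner2025.thm652_stabilized_rankOne_charIdeal_torsion_dvd_pLocalized`, p610515:
`char_Λ(𝒳_tors) = J²`, `J ∣ (p^m)·I(Λκ_∞(C))`), by the divisor calculus of characteristic ideals read at one
prime (`lengthAt_le_two_mul_of_span_singleton_mul_sq_le`: `(x)·char(B)² ⊆ char(A)` gives
`length_𝔮(A) ≤ 2·length_𝔮(B)` at every height-one `𝔮 ∌ x`, through the comparison module `R/(x) ⊕ B ⊕ B` and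
`SkinnerUrban2014.lengthAt_le_of_charIdeal_le`). The slack term `length_𝔮(Λ/(p^m))` vanishes exactly when
`𝔮 ≠ (p)`: the kernel-visible reason why `(p)` is the ONLY height-one prime at which the Heegner-point containment
of rows 9/10 is not print, i.e. why the residual crux is the μ-part and nothing else.

WHY THIS IS THE T3 / BC5 RECORD FOR THE SHARED μ-CRUX (planner.md 4b BC5: "a sibling-setting analogue OF C in a
regime where S is NOT already known … or a model where C's analogue is decided and S's is not"). C = the letter at
`𝔭 = (p)`; its analogue at every `𝔮 ≠ (p)` is DECIDED here from print, for every class number including the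
route's regime `p ∣ h_K`; S = `Rank1Residual.BSDpOnClassX9` (resp. the X10b corner) is not known in any regime of
class X9/X10b. The rung exercises the routes' lever (Howard/CGLS/CGS Kolyvagin-system divisibility in the
stabilised currency, read prime by prime) and isolates what the lever does NOT give: the `p^m`-ambiguity of
Thm. 6.5.2 (ii), which only a μ-input (the letter; Howard's Eisenstein specialisation under `p ∤ h_K`; MZ26 Cor. 4.6
under its Assumption 2.1 (iii)) removes — cf. the tree's converse bookkeeping
`IwasawaAlgebra.sq_charIdeal_le_charIdeal_of_span_p_pow_mul_le_of_lengthAt_le_two_mul` (the letter at `(p)` +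
Thm. 6.5.2 ⟹ Howard's containment `I(Λκ_∞)² ⊆ char(𝒳_tors)`).

HONEST FRAMING: a consequence of a PUBLISHED theorem taken as a hypothesis (`h652`), nothing more; it does not
prove the letter, Howard's Theorem B at `p ∣ h_K`, any crux of PrintX9 / PrintX10b, or BSD. BSD is NOT proved by
this file. «beyond-print theorem»: no.

References: [CastellaGrossiSkinner2025] Math. Ann. 393 (2025) 2451–2506 = arXiv:2303.04373, Thm. 6.5.2;
[CastellaGrossiLeeSkinner2022] Invent. Math. 227 (2022) = arXiv:2008.02571, Thm. 4.1.3, Rem. 4.1.4;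
[Howard2004HeegnerKolyvagin] Compos. Math. 140 (2004), Thm. B and proof of Thm. 2.2.10; [SkinnerUrban2014] §3.1.6;
[Washington1997] §13.2; [NeukirchSchmidtWingberg2008] Ch. V §3 (5.3.9)–(5.3.10).
-/

set_option linter.dupNamespace false
set_option autoImplicit false

noncomputable section

open scoped Classical Pointwise
open Literature Literature.NumberTheory.EllipticCurves WeierstrassCurve

namespace Summit.BirchSwinnertonDyer.BirchSwinnertonDyer.Theorems.HeegnerMuPartStabilizedOffP

/-! ### 1. Divisor calculus at one height-one prime: `(x)·char(B)² ⊆ char(A)`, `x ∉ 𝔮` ⟹ `ℓ_𝔮(A) ≤ 2 ℓ_𝔮(B)` -/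

section DivisorCalculus

variable {R : Type*} [CommRing R] [IsNoetherianRing R] [IsDomain R]

omit [IsNoetherianRing R] in
/-- `R/(x)` is a torsion `R`-module for `x ≠ 0` in a domain. [folklore] -/
private theorem isTorsion_quotient_span_singleton {x : R} (hx : x ≠ 0) :
    Module.IsTorsion R (R ⧸ Ideal.span {x}) := by
  intro q
  refine ⟨⟨x, mem_nonZeroDivisors_of_ne_zero hx⟩, ?_⟩
  obtain ⟨r, rfl⟩ := Ideal.Quotient.mk_surjective q
  change x • Ideal.Quotient.mk (Ideal.span {x}) r = 0
  rw [← Ideal.Quotient.mk_eq_mk, ← Submodule.Quotient.mk_smul, Submodule.Quotient.mk_eq_zero,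
    smul_eq_mul]
  exact Ideal.mul_mem_right r _ (Ideal.mem_span_singleton_self x)

omit [IsNoetherianRing R] [IsDomain R] in
/-- A binary product of torsion modules is torsion. [folklore] -/
private theorem isTorsion_prod {M₁ M₂ : Type*} [AddCommGroup M₁] [_root_.Module R M₁]
    [AddCommGroup M₂] [_root_.Module R M₂]
    (h₁ : Module.IsTorsion R M₁) (h₂ : Module.IsTorsion R M₂) :
    Module.IsTorsion R (M₁ × M₂) := by
  intro x
  obtain ⟨a, ha⟩ := @h₁ x.1
  obtain ⟨b, hb⟩ := @h₂ x.2
  refine ⟨b * a, Prod.ext ?_ ?_⟩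
  · change ((b * a : nonZeroDivisors R) : R) • x.1 = 0
    rw [Submonoid.coe_mul, mul_smul]
    change (b : R) • ((a : nonZeroDivisors R) • x.1) = 0
    rw [ha, smul_zero]
  · change ((b * a : nonZeroDivisors R) : R) • x.2 = 0
    rw [Submonoid.coe_mul, mul_comm, mul_smul]
    change (a : R) • ((b : nonZeroDivisors R) • x.2) = 0
    rw [hb, smul_zero]

/-- `char(M₁ ⊕ M₂) = char(M₁)·char(M₂)` for finitely generated torsion modules over a Noetherian domain
(multiplicativity in the split exact sequence, `Module.charIdeal_eq_mul_of_exact`).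
[cite: NeukirchSchmidtWingberg2008, Ch. V §3, Remark 2 after (5.3.9) (p. 293)] -/
private theorem charIdeal_prod {M₁ M₂ : Type*} [AddCommGroup M₁] [_root_.Module R M₁]
    [AddCommGroup M₂] [_root_.Module R M₂] [Module.Finite R M₁] [Module.Finite R M₂]
    (h₁ : Module.IsTorsion R M₁) (h₂ : Module.IsTorsion R M₂) :
    Module.charIdeal R (M₁ × M₂) = Module.charIdeal R M₁ * Module.charIdeal R M₂ :=
  Module.charIdeal_eq_mul_of_exact (isTorsion_prod h₁ h₂) (LinearMap.inl R M₁ M₂)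
    (LinearMap.snd R M₁ M₂) LinearMap.inl_injective LinearMap.snd_surjective .inl_snd

variable [UniqueFactorizationMonoid R]

/-- **Divisor calculus at one prime.** `R` a Noetherian factorial domain, `A`, `B` finitely generated torsion
`R`-modules, `x ≠ 0`: if `(x) · char(B)² ⊆ char(A)` then `length_𝔮(A) ≤ 2 · length_𝔮(B)` at every height-one
prime `𝔮` NOT containing `x` — compare `A` with `M = R/(x) ⊕ B ⊕ B`, whose characteristic ideal is
`(x)·char(B)²` (`charIdeal_prod`, `Module.charIdeal_quotient_span_singleton`) and whose length at `𝔮 ∌ x` is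
`0 + ℓ_𝔮(B) + ℓ_𝔮(B)` (`Module.lengthAt_prod`, `Module.lengthAt_quotient_eq_zero_of_not_le`), through
`SkinnerUrban2014.lengthAt_le_of_charIdeal_le` ("`char(M) ⊆ char(A) ⟹ ℓ_𝔮(A) ≤ ℓ_𝔮(M)`").
(Washington §13.2; NSW (5.3.9)–(5.3.10): `ord_𝔮` is additive and monotone under divisibility.)
[cite: Washington1997, §13.2] [cite: NeukirchSchmidtWingberg2008, Ch. V §3, (5.3.9)–(5.3.10)]
[cite: SkinnerUrban2014, §3.1.6 (p. 20)] -/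
theorem lengthAt_le_two_mul_of_span_singleton_mul_sq_le
    {A : Type*} [AddCommGroup A] [_root_.Module R A] [Module.Finite R A]
    {B : Type*} [AddCommGroup B] [_root_.Module R B] [Module.Finite R B]
    (hA : Module.IsTorsion R A) (hB : Module.IsTorsion R B) {x : R} (hx : x ≠ 0)
    (h : Ideal.span {x} * Module.charIdeal R B ^ 2 ≤ Module.charIdeal R A)
    (𝔮 : PrimeSpectrum R) (h𝔮 : 𝔮.asIdeal.height = 1) (hx𝔮 : x ∉ 𝔮.asIdeal) :
    Module.lengthAt R A 𝔮 ≤ 2 * Module.lengthAt R B 𝔮 := by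
  classical
  have hQ : Module.IsTorsion R (R ⧸ Ideal.span {x}) := isTorsion_quotient_span_singleton hx
  have hBB : Module.IsTorsion R (B × B) := isTorsion_prod hB hB
  have hM : Module.IsTorsion R ((R ⧸ Ideal.span {x}) × (B × B)) := isTorsion_prod hQ hBB
  have hchar : Module.charIdeal R ((R ⧸ Ideal.span {x}) × (B × B)) =
      Ideal.span {x} * Module.charIdeal R B ^ 2 := by
    rw [charIdeal_prod hQ hBB, charIdeal_prod hB hB, Module.charIdeal_quotient_span_singleton hx, sq]
  have hle := SkinnerUrban2014.lengthAt_le_of_charIdeal_le hM hA (hchar.le.trans h) 𝔮 h𝔮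
  rwa [Module.lengthAt_prod, Module.lengthAt_prod,
    Module.lengthAt_quotient_eq_zero_of_not_le (by rwa [Ideal.span_singleton_le_iff_mem]),
    zero_add, ← two_mul] at hle

end DivisorCalculus

/-! ### 2. The statements: the letter away from `(p)` (verbatim binders) and its minimal form -/

/-- **The μ-letter AWAY FROM `(p)`, verbatim binders** — `HeegnerMuPartStabilized.MuPartStabilizedOfPrint`
(p625984) with its last binder `𝔭.asIdeal = Ideal.span {(p : Λ)}` replaced by
`𝔭.asIdeal.height = 1 → 𝔭.asIdeal ≠ Ideal.span {(p : Λ)}`: under `Thm413Hypotheses`, `E` non-CM, `E[p]`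
irreducible over `ℚ` and `K`, scalars in the `p`-adic image, `p` split, `p ∣ h_K`, for all `D`, `C`, `X` with
`𝔖`, `𝒳` finitely generated and `𝔖/Λκ_∞(C)` torsion, `length_𝔮(𝒳_tors) ≤ 2·length_𝔮(𝔖/Λκ_∞(C))` at every
height-one `𝔮 ≠ (p)`. PROVED below from CGS 2025 Thm. 6.5.2 (most binders unused). A statement abbreviation (`abbrev … : Prop`, like the letter), not a
named fact. -/
abbrev MuPartStabilizedOfPrintOffP : Prop :=
  ∀ (N : ℕ) [NeZero N] (W : WeierstrassCurve ℚ) [W.IsGloballyMinimal] (K : Type) [Field K] [NumberField K]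
    (p : ℕ) [Fact p.Prime] (κ : ZpExtension K p) (γ : Field.absoluteGaloisGroup K)
    (jbar : AlgebraicClosure K →+* ℂ),
    CastellaGrossiLeeSkinner2022.Thm413Hypotheses N W K p κ γ →
    ¬ W.HasCM → W.HasIrreducibleModPGaloisRep p → (W.baseChange K).HasIrreducibleModPGaloisRep p →
    MastellaZerman2026.HasPadicScalarImage W p → SatisfiesHeegnerHypothesis p K →
    p ∣ NumberField.classNumber K →
    ∀ (D : (W.baseChange K).LambdaAdicSelmerData κ γ)
      (C : CastellaGrossiLeeSkinner2022.StabilizedHeegnerData N W K κ jbar)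
      (X : (W.baseChange K).SelmerDualData κ γ),
    Module.Finite (IwasawaAlgebra p) D.S → Module.Finite (IwasawaAlgebra p) X.X →
    Module.IsTorsion (IwasawaAlgebra p) (D.S ⧸ CastellaGrossiLeeSkinner2022.stabilizedHeegnerModule D C) →
    ∀ 𝔭 : PrimeSpectrum (IwasawaAlgebra p), 𝔭.asIdeal.height = 1 →
      𝔭.asIdeal ≠ Ideal.span {(p : IwasawaAlgebra p)} →
      Module.lengthAt (IwasawaAlgebra p) (Submodule.torsion (IwasawaAlgebra p) X.X) 𝔭 ≤
        2 * Module.lengthAt (IwasawaAlgebra p)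
          (D.S ⧸ CastellaGrossiLeeSkinner2022.stabilizedHeegnerModule D C) 𝔭

/-- **(L∃) The SHARED μ-ITEM's letter AWAY FROM `(p)`, verbatim binders** — THE CUT v2 (plan g10,
2026-08-28T12:02:33Z): the shared item of rows 9/10 is `HeegnerMuPartStabilized.MuPartStabilizedCoherentPair`
(p630902) verbatim, decl `MuInequalityCoherentPair` on both routes. This is THAT TEXT with the innermost binder
`𝔭.asIdeal = Ideal.span {(p : Λ)}` replaced by `𝔭.asIdeal.height = 1 → 𝔭.asIdeal ≠ Ideal.span {(p : Λ)}`: for every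
parametrisation `Dt`, orientation `β` and Selmer data `D`, `X` THERE ARE a stabilised datum `C` and a Howard family `F`
on `(Dt, β)`, commensurable (`ℋ_∞(F) ≤ Λκ_∞(C)`, `g • Λκ_∞(C) ≤ ℋ_∞(F)`, `g ≠ 0`), with
`length_𝔮(𝒳_tors) ≤ 2·length_𝔮(𝔖/Λκ_∞(C))` at every height-one `𝔮 ≠ (p)`. PROVED below (engine
`exists_coherent_pair_envelope` + CGS 2025 Thm. 6.5.2). A statement abbreviation, not a named fact. -/
abbrev MuPartStabilizedCoherentPairOffP : Prop :=
  ∀ (N : ℕ) [NeZero N] (W : WeierstrassCurve ℚ) [W.IsGloballyMinimal] (K : Type) [Field K] [NumberField K]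
    (p : ℕ) [Fact p.Prime] (κ : ZpExtension K p) (γ : Field.absoluteGaloisGroup K)
    (jbar : AlgebraicClosure K →+* ℂ),
    CastellaGrossiLeeSkinner2022.Thm413Hypotheses N W K p κ γ →
    ¬ W.HasCM → W.HasIrreducibleModPGaloisRep p → (W.baseChange K).HasIrreducibleModPGaloisRep p →
    MastellaZerman2026.HasPadicScalarImage W p → SatisfiesHeegnerHypothesis p K →
    p ∣ NumberField.classNumber K →
    ¬ p ∣ N →
    (∀ k, ringClassSubgroup K (p ^ (k + 1)) jbar ≤ κ.layerSubgroup k) →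
    Nat.card (ringClassGalOver (jbar.comp (algebraMap K (AlgebraicClosure K))) p 1) = p - 1 →
    ∀ (Dt : ModularForms.ModularParametrizationData W N) (β : ℤ), (4 * N : ℤ) ∣ β ^ 2 - NumberField.discr K →
    ∀ (D : (W.baseChange K).LambdaAdicSelmerData κ γ) (X : (W.baseChange K).SelmerDualData κ γ),
    ∃ (C : CastellaGrossiLeeSkinner2022.StabilizedHeegnerData N W K κ jbar) (F : HeegnerFamily N W K κ jbar),
      C.Dt = Dt ∧ F.Dt = Dt ∧ C.β = β ∧ F.β = β ∧
      heegnerModule D F ≤ CastellaGrossiLeeSkinner2022.stabilizedHeegnerModule D C ∧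
      (∃ g : IwasawaAlgebra p, g ≠ 0 ∧
        g • CastellaGrossiLeeSkinner2022.stabilizedHeegnerModule D C ≤ heegnerModule D F) ∧
      (Module.Finite (IwasawaAlgebra p) D.S → Module.Finite (IwasawaAlgebra p) X.X →
        Module.IsTorsion (IwasawaAlgebra p)
          (D.S ⧸ CastellaGrossiLeeSkinner2022.stabilizedHeegnerModule D C) →
        ∀ 𝔭 : PrimeSpectrum (IwasawaAlgebra p), 𝔭.asIdeal.height = 1 →
          𝔭.asIdeal ≠ Ideal.span {(p : IwasawaAlgebra p)} →
          Module.lengthAt (IwasawaAlgebra p) (Submodule.torsion (IwasawaAlgebra p) X.X) 𝔭 ≤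
            2 * Module.lengthAt (IwasawaAlgebra p)
              (D.S ⧸ CastellaGrossiLeeSkinner2022.stabilizedHeegnerModule D C) 𝔭)

/-- **Minimal form**: under `CastellaGrossiLeeSkinner2022.Thm413Hypotheses N W K p κ γ` ONLY (any class number,
any Selmer corank, no image hypothesis beyond `E(K)[p] = 0`), for all `D`, `C`, `X` with `𝔖/Λκ_∞(C)` torsion:
`length_𝔮(𝒳_tors) ≤ 2·length_𝔮(𝔖/Λκ_∞(C))` at every height-one prime `𝔮 ≠ (p)` of `Λ`. PROVED below from
CGS 2025 Thm. 6.5.2. A statement abbreviation (`abbrev … : Prop`, like the letter), not a named fact. -/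
abbrev StabilizedLengthBoundOffP : Prop :=
  ∀ (N : ℕ) [NeZero N] (W : WeierstrassCurve ℚ) [W.IsGloballyMinimal] (K : Type) [Field K] [NumberField K]
    (p : ℕ) [Fact p.Prime] (κ : ZpExtension K p) (γ : Field.absoluteGaloisGroup K)
    (jbar : AlgebraicClosure K →+* ℂ),
    CastellaGrossiLeeSkinner2022.Thm413Hypotheses N W K p κ γ →
    ∀ (D : (W.baseChange K).LambdaAdicSelmerData κ γ)
      (C : CastellaGrossiLeeSkinner2022.StabilizedHeegnerData N W K κ jbar)
      (X : (W.baseChange K).SelmerDualData κ γ),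
    Module.IsTorsion (IwasawaAlgebra p) (D.S ⧸ CastellaGrossiLeeSkinner2022.stabilizedHeegnerModule D C) →
    ∀ 𝔮 : PrimeSpectrum (IwasawaAlgebra p), 𝔮.asIdeal.height = 1 →
      𝔮.asIdeal ≠ Ideal.span {(p : IwasawaAlgebra p)} →
      Module.lengthAt (IwasawaAlgebra p) (Submodule.torsion (IwasawaAlgebra p) X.X) 𝔮 ≤
        2 * Module.lengthAt (IwasawaAlgebra p)
          (D.S ⧸ CastellaGrossiLeeSkinner2022.stabilizedHeegnerModule D C) 𝔮

/-- Unfolding lemma (`Iff.rfl`) for item filing by signature. [folklore] -/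
theorem stabilizedLengthBoundOffP_iff :
    StabilizedLengthBoundOffP ↔
      ∀ (N : ℕ) [NeZero N] (W : WeierstrassCurve ℚ) [W.IsGloballyMinimal] (K : Type) [Field K] [NumberField K]
        (p : ℕ) [Fact p.Prime] (κ : ZpExtension K p) (γ : Field.absoluteGaloisGroup K)
        (jbar : AlgebraicClosure K →+* ℂ),
        CastellaGrossiLeeSkinner2022.Thm413Hypotheses N W K p κ γ →
        ∀ (D : (W.baseChange K).LambdaAdicSelmerData κ γ)
          (C : CastellaGrossiLeeSkinner2022.StabilizedHeegnerData N W K κ jbar)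
          (X : (W.baseChange K).SelmerDualData κ γ),
        Module.IsTorsion (IwasawaAlgebra p) (D.S ⧸ CastellaGrossiLeeSkinner2022.stabilizedHeegnerModule D C) →
        ∀ 𝔮 : PrimeSpectrum (IwasawaAlgebra p), 𝔮.asIdeal.height = 1 →
          𝔮.asIdeal ≠ Ideal.span {(p : IwasawaAlgebra p)} →
          Module.lengthAt (IwasawaAlgebra p) (Submodule.torsion (IwasawaAlgebra p) X.X) 𝔮 ≤
            2 * Module.lengthAt (IwasawaAlgebra p)
              (D.S ⧸ CastellaGrossiLeeSkinner2022.stabilizedHeegnerModule D C) 𝔮 :=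
  Iff.rfl

/-! ### 3. Proofs from CGS 2025 Thm. 6.5.2 (the named fact binding both routes' `closes` as `hCGS`) -/

/-- **The minimal form from Castella–Grossi–Skinner 2025 Thm. 6.5.2.** `char(𝒳_tors) = J²` and
`J ∣ (p^m)·I(Λκ_∞(C))` give `(p^{2m})·I(Λκ_∞(C))² ⊆ char(𝒳_tors)`
(`span_pow_mul_sq_le_charIdeal_torsion_of_thm652_stabilized`); `p` is prime in `Λ` (`IwasawaAlgebra.prime_natCast`),
so a height-one `𝔮 ≠ (p)` does not contain `p^{2m}` (`Ideal.eq_span_singleton_of_height_eq_one`), and the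
divisor calculus (`lengthAt_le_two_mul_of_span_singleton_mul_sq_le`) reads the containment at `𝔮`.
[cite: CastellaGrossiSkinner2025, Thm. 6.5.2 (i)–(ii)] [cite: Washington1997, §13.2] -/
theorem stabilizedLengthBoundOffP_of_thm652
    (h652 : CastellaGrossiSkinner2025.thm652_stabilized_rankOne_charIdeal_torsion_dvd_pLocalized.{0}) :
    StabilizedLengthBoundOffP := by
  intro N _ W _ K _ _ p _ κ γ jbar hyp D C X hT 𝔮 h𝔮 hne
  obtain ⟨⟨hSf, -⟩, hXf, -, -⟩ := h652 N W K p κ γ jbar hyp D C X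
  haveI : Module.Finite (IwasawaAlgebra p) D.S := hSf
  haveI : Module.Finite (IwasawaAlgebra p) X.X := hXf
  haveI : IsNoetherian (IwasawaAlgebra p) X.X := isNoetherian_of_isNoetherianRing_of_finite _ _
  obtain ⟨m, hm⟩ :=
    CastellaGrossiSkinner2025.span_pow_mul_sq_le_charIdeal_torsion_of_thm652_stabilized h652 hyp D C X
  rw [CastellaGrossiLeeSkinner2022.stabilizedHeegnerCharIdeal_def] at hm
  have hp : (p : IwasawaAlgebra p) ∉ 𝔮.asIdeal := fun hp𝔮 =>
    hne (Ideal.eq_span_singleton_of_height_eq_one h𝔮 hp𝔮 IwasawaAlgebra.prime_natCast)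
  have hpm : (p : IwasawaAlgebra p) ^ m ∉ 𝔮.asIdeal := fun h => hp (𝔮.isPrime.mem_of_pow_mem m h)
  exact lengthAt_le_two_mul_of_span_singleton_mul_sq_le (Submodule.torsion_isTorsion (M := X.X)) hT
    (pow_ne_zero m IwasawaAlgebra.prime_natCast.ne_zero) hm 𝔮 h𝔮 hpm

/-- **The letter away from `(p)`, verbatim binders, from CGS 2025 Thm. 6.5.2** (the image hypotheses, `p`
split, `p ∣ h_K` and the two finiteness binders are not used). [cite: CastellaGrossiSkinner2025, Thm. 6.5.2 (i)–(ii)] -/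
theorem muPartStabilizedOfPrintOffP_of_thm652
    (h652 : CastellaGrossiSkinner2025.thm652_stabilized_rankOne_charIdeal_torsion_dvd_pLocalized.{0}) :
    MuPartStabilizedOfPrintOffP :=
  fun N _ W _ K _ _ p _ κ γ jbar hyp _ _ _ _ _ _ D C X _ _ hT 𝔭 h𝔭 hne =>
    stabilizedLengthBoundOffP_of_thm652 h652 N W K p κ γ jbar hyp D C X hT 𝔭 h𝔭 hne

/-- **The minimal form implies the verbatim-binder form** (discard binders). [folklore] -/
theorem muPartStabilizedOfPrintOffP_of_stabilizedLengthBoundOffP (h : StabilizedLengthBoundOffP) :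
    MuPartStabilizedOfPrintOffP :=
  fun N _ W _ K _ _ p _ κ γ jbar hyp _ _ _ _ _ _ D C X _ _ hT 𝔭 h𝔭 hne =>
    h N W K p κ γ jbar hyp D C X hT 𝔭 h𝔭 hne

/-- **(L∃) away from `(p)` from the minimal form**: run the coherent-pair engine `exists_coherent_pair_envelope`
(CGLS Rem. 4.1.4 / Howard Thm. 3.3.7 in the tree, any class number) exactly as `muPartStabilizedCoherentPair_of_print`
does, and read the minimal off-`(p)` form at ITS `C`. [cite: CastellaGrossiLeeSkinner2022, Rem. 4.1.4 (arXiv:2008.02571v2 TeX L2278–2294)]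
[cite: Howard2004HeegnerKolyvagin, §3.3 and Thm. 3.3.7] -/
theorem muPartStabilizedCoherentPairOffP_of_stabilizedLengthBoundOffP (h : StabilizedLengthBoundOffP) :
    MuPartStabilizedCoherentPairOffP := by
  intro N _ W _ K _ _ p _ κ γ jbar hyp _ _ _ _ _ _ hpN hTw1 hcardp Dt β hβ D X
  have hlev : N = W.conductorNorm ℤ := hyp.level
  subst hlev
  haveI : W.IsElliptic := hyp.isElliptic
  obtain ⟨C, F, hCDt, hFDt, hCβ, hFβ, hfwd, g, hg, hrev⟩ :=
    exists_coherent_pair_envelope (W := W) hyp.isImaginaryQuadratic hyp.heegner Dt hβ jbar hyp.ordinary hpN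
      κ hyp.topGenerator hTw1 hcardp hyp.noPTorsion D
  exact ⟨C, F, hCDt, hFDt, hCβ, hFβ, hfwd, ⟨g, hg, hrev⟩, fun _ _ htor 𝔭 h𝔭 hne ↦
    h _ W K p κ γ jbar hyp D C X htor 𝔭 h𝔭 hne⟩

/-- **(L∃) away from `(p)` from Castella–Grossi–Skinner 2025 Thm. 6.5.2** — the shared μ-item's text with the prime
changed is a consequence of print + the tree's coherent-pair engine. [cite: CastellaGrossiSkinner2025, Thm. 6.5.2 (i)–(ii)]
[cite: CastellaGrossiLeeSkinner2022, Rem. 4.1.4] -/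
theorem muPartStabilizedCoherentPairOffP_of_thm652
    (h652 : CastellaGrossiSkinner2025.thm652_stabilized_rankOne_charIdeal_torsion_dvd_pLocalized.{0}) :
    MuPartStabilizedCoherentPairOffP :=
  muPartStabilizedCoherentPairOffP_of_stabilizedLengthBoundOffP (stabilizedLengthBoundOffP_of_thm652 h652)

/-- **What the letter adds, in one line (bookkeeping).** The letter at `(p)` together with its off-`(p)` twin
is the local inequality at EVERY height-one prime of `Λ`: for fixed data, `MuPartStabilizedOfPrint`'s conclusion
at `𝔭 = (p)` and `StabilizedLengthBoundOffP`'s at `𝔮 ≠ (p)` assemble to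
`∀ 𝔮, ht 𝔮 = 1 → length_𝔮(𝒳_tors) ≤ 2·length_𝔮(𝔖/Λκ_∞(C))` (case split on `𝔮 = (p)`). [folklore] -/
theorem lengthAt_le_two_mul_forall_heightOne_of_at_p_of_offP {p : ℕ} [Fact p.Prime]
    {A : Type*} [AddCommGroup A] [_root_.Module (IwasawaAlgebra p) A]
    {B : Type*} [AddCommGroup B] [_root_.Module (IwasawaAlgebra p) B]
    (hAt : ∀ 𝔭 : PrimeSpectrum (IwasawaAlgebra p), 𝔭.asIdeal = Ideal.span {(p : IwasawaAlgebra p)} →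
      Module.lengthAt (IwasawaAlgebra p) A 𝔭 ≤ 2 * Module.lengthAt (IwasawaAlgebra p) B 𝔭)
    (hOff : ∀ 𝔮 : PrimeSpectrum (IwasawaAlgebra p), 𝔮.asIdeal.height = 1 →
      𝔮.asIdeal ≠ Ideal.span {(p : IwasawaAlgebra p)} →
      Module.lengthAt (IwasawaAlgebra p) A 𝔮 ≤ 2 * Module.lengthAt (IwasawaAlgebra p) B 𝔮) :
    ∀ 𝔮 : PrimeSpectrum (IwasawaAlgebra p), 𝔮.asIdeal.height = 1 →
      Module.lengthAt (IwasawaAlgebra p) A 𝔮 ≤ 2 * Module.lengthAt (IwasawaAlgebra p) B 𝔮 := by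
  intro 𝔮 h𝔮
  by_cases h : 𝔮.asIdeal = Ideal.span {(p : IwasawaAlgebra p)}
  · exact hAt 𝔮 h
  · exact hOff 𝔮 h𝔮 h

end Summit.BirchSwinnertonDyer.BirchSwinnertonDyer.Theorems.HeegnerMuPartStabilizedOffP

end
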